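import Summits.Ventures.HodgeRepro.CyclicFourier

/-!
# Fourier analysis on the plane `ℤ/p × ℤ/p` (the toolkit of `PlaneQuadCore`)

Blind re-derivation cell `pub-hodge-repro`, seat `p1` (gen 12).  The family (ii) of P1.md §16g's «Consequence» —
`C₂ × C_p × C_p` with `c = (1, 0, 0)`, `p` an odd prime — lives over the plane `V = ℤ/p × ℤ/p`; its analysis needs
the two-dimensional Fourier transform, which Mathlib's `ZMod.dft` (one-dimensional) does not provide.  This file builds
it from the standard character `ψ = ZMod.stdAddChar : AddChar (ZMod p) ℂ` and the pairing `⟨k, y⟩ = k₁ y₁ + k₂ y₂`: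

* `ft f k = ∑_y f(y) ψ(−⟨k, y⟩)` with the translation rule `ft_shift` and the inversion formula `ft_inversion`
  (`p² f(y) = ∑_k 𝓕f(k) ψ(⟨k, y⟩)`, from the orthogonality `sum_char_dot`: `∑_k ψ(⟨k, w⟩) = p² [w = 0]`, itself the
  square of Mathlib's `AddChar.sum_mulShift`);
* `pair_of_sum_eq` — **Vieta on the `p`-th roots of unity**: for `p` an odd prime, `ψ a + ψ b = ψ c + ψ d` forces
  `{a, b} = {c, d}` (as multisets).  Complex conjugation gives `u⁻¹ + v⁻¹ = u'⁻¹ + v'⁻¹`, and since `u + v ≠ 0`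
  (`ψ a + ψ b = 0` would make `ψ(b − a) = −1`, impossible for odd `p`: `char_add_char_ne_zero`) the products agree,
  `u v = u' v'`; so `{u, v}` and `{u', v'}` are the roots of the same quadratic (`vieta_aux`).

Everything is on Mathlib only; gen 8's `CyclicFourier.lean` supplies the norm / conjugation / non-vanishing facts
about `ψ`.
-/

set_option autoImplicit false

open Finset AddChar ZMod
open scoped Pointwise

namespace HodgeRepro.PlaneQuad

open HodgeRepro.CyclicQuad

variable {p : ℕ} [NeZero p]

/-! ### The pairing `⟨k, y⟩` on the plane -/

/-- The pairing `⟨k, y⟩ = k₁ y₁ + k₂ y₂` on `ℤ/p × ℤ/p`. -/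
def dot (k y : ZMod p × ZMod p) : ZMod p := k.1 * y.1 + k.2 * y.2

omit [NeZero p] in
/-- The pairing is additive in its second argument. -/
theorem dot_add_right (k y z : ZMod p × ZMod p) : dot k (y + z) = dot k y + dot k z := by
  simp only [dot, Prod.fst_add, Prod.snd_add]; ring

omit [NeZero p] in
/-- The pairing respects subtraction in its second argument. -/
theorem dot_sub_right (k y z : ZMod p × ZMod p) : dot k (y - z) = dot k y - dot k z := by
  simp only [dot, Prod.fst_sub, Prod.snd_sub]; ring

omit [NeZero p] in
/-- The pairing of a pair `(k₁, k₂)` with `w` is `k₁ w₁ + k₂ w₂`. -/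
theorem dot_mk (k₁ k₂ : ZMod p) (w : ZMod p × ZMod p) : dot (k₁, k₂) w = k₁ * w.1 + k₂ * w.2 := rfl

/-! ### The plane Fourier transform -/

/-- The plane Fourier transform `𝓕f(k) = ∑_y f(y) ψ(−⟨k, y⟩)`. -/
noncomputable def ft (f : ZMod p × ZMod p → ℂ) (k : ZMod p × ZMod p) : ℂ :=
  ∑ y, f y * stdAddChar (-(dot k y))

/-- Translation becomes multiplication by a character value: `𝓕(f(· − u))(k) = ψ(−⟨k, u⟩) 𝓕f(k)`. -/
theorem ft_shift (f : ZMod p × ZMod p → ℂ) (u k : ZMod p × ZMod p) :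
    ft (fun y => f (y - u)) k = stdAddChar (-(dot k u)) * ft f k := by
  unfold ft
  rw [Finset.mul_sum]
  refine Fintype.sum_equiv (Equiv.subRight u) _ _ (fun y => ?_)
  simp only [Equiv.subRight_apply]
  rw [show -(dot k y) = -(dot k u) + -(dot k (y - u)) by rw [dot_sub_right]; ring, map_add_eq_mul]
  ring

/-- One-dimensional orthogonality: `∑_k ψ(k w) = p · [w = 0]`. -/
theorem sum_char_mul (w : ZMod p) :
    ∑ k : ZMod p, stdAddChar (k * w) = if w = 0 then (p : ℂ) else 0 := by
  rw [AddChar.sum_mulShift w (isPrimitive_stdAddChar p)]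
  split_ifs <;> simp [ZMod.card]

/-- Two-dimensional orthogonality: `∑_k ψ(⟨k, w⟩) = p² · [w = 0]`. -/
theorem sum_char_dot (w : ZMod p × ZMod p) :
    ∑ k : ZMod p × ZMod p, stdAddChar (dot k w) = if w = 0 then (p : ℂ) ^ 2 else 0 := by
  rw [Fintype.sum_prod_type]
  have hsplit : ∀ k₁ k₂ : ZMod p,
      stdAddChar (dot (k₁, k₂) w) = stdAddChar (k₁ * w.1) * stdAddChar (k₂ * w.2) := by
    intro k₁ k₂; rw [← map_add_eq_mul, dot_mk]
  simp only [hsplit]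
  rw [← Finset.sum_mul_sum, sum_char_mul, sum_char_mul]
  have hw : w = 0 ↔ w.1 = 0 ∧ w.2 = 0 := by simp [Prod.ext_iff]
  by_cases h1 : w.1 = 0 <;> by_cases h2 : w.2 = 0
  · rw [if_pos h1, if_pos h2, if_pos (hw.mpr ⟨h1, h2⟩), sq]
  · rw [if_pos h1, if_neg h2, if_neg (fun h => h2 (hw.mp h).2), mul_zero]
  · rw [if_neg h1, if_pos h2, if_neg (fun h => h1 (hw.mp h).1), zero_mul]
  · rw [if_neg h1, if_neg h2, if_neg (fun h => h1 (hw.mp h).1), zero_mul]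

/-- **Fourier inversion on the plane**: `∑_k 𝓕f(k) ψ(⟨k, y⟩) = p² f(y)`. -/
theorem ft_inversion (f : ZMod p × ZMod p → ℂ) (y : ZMod p × ZMod p) :
    ∑ k, ft f k * stdAddChar (dot k y) = (p : ℂ) ^ 2 * f y := by
  unfold ft
  simp only [Finset.sum_mul]
  rw [Finset.sum_comm]
  have hterm : ∀ z k : ZMod p × ZMod p,
      f z * stdAddChar (-(dot k z)) * stdAddChar (dot k y) = f z * stdAddChar (dot k (y - z)) := by
    intro z k
    rw [mul_assoc, ← map_add_eq_mul, dot_sub_right]; congr 2; ring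
  simp only [hterm]
  simp only [← Finset.mul_sum, sum_char_dot, sub_eq_zero]
  simp only [mul_ite, mul_zero]
  rw [Finset.sum_ite_eq, if_pos (Finset.mem_univ _)]
  ring

/-! ### Character values on `ℤ/p`, `p` an odd prime -/

/-- `ψ x = 1` exactly at `x = 0`. -/
theorem stdAddChar_eq_one_iff (x : ZMod p) : stdAddChar x = 1 ↔ x = 0 := by
  constructor
  · intro h; exact injective_stdAddChar (h.trans (map_zero_eq_one _).symm)
  · rintro rfl; exact map_zero_eq_one _

omit [NeZero p] in
/-- `2 ≠ 0` in `ℤ/p` for an odd prime `p`. -/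
theorem two_ne_zero_of_odd (hp : p.Prime) (hp2 : p ≠ 2) : (2 : ZMod p) ≠ 0 := by
  intro h
  have h' : ((2 : ℕ) : ZMod p) = 0 := by exact_mod_cast h
  rw [ZMod.natCast_eq_zero_iff] at h'
  exact hp2 ((Nat.prime_dvd_prime_iff_eq hp Nat.prime_two).mp h')

/-- For an odd prime `p`, two values of `ψ` never cancel: `ψ a + ψ b ≠ 0`. -/
theorem char_add_char_ne_zero (hp : p.Prime) (hp2 : p ≠ 2) (a b : ZMod p) :
    stdAddChar a + stdAddChar b ≠ 0 := by
  haveI := Fact.mk hp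
  intro h
  have h1 : stdAddChar (b - a) = -1 := by
    rw [map_sub_eq_div, div_eq_iff (stdAddChar_ne_zero a)]
    linear_combination h
  have h2 : stdAddChar (2 * (b - a)) = 1 := by
    rw [two_mul, map_add_eq_mul, h1]; norm_num
  rw [stdAddChar_eq_one_iff, mul_eq_zero] at h2
  rcases h2 with h2 | h2
  · exact two_ne_zero_of_odd hp hp2 h2
  · rw [h2, map_zero_eq_one] at h1; norm_num at h1

/-- Algebraic core of the Vieta lemma: non-zero `u, v, u', v'` with `u + v = u' + v'`,
`u⁻¹ + v⁻¹ = u'⁻¹ + v'⁻¹` and `u + v ≠ 0` satisfy `u = u'` or `u = v'`. -/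
theorem vieta_aux {u v u' v' : ℂ} (hu : u ≠ 0) (hv : v ≠ 0) (hu' : u' ≠ 0) (hv' : v' ≠ 0)
    (h : u + v = u' + v') (hc : u⁻¹ + v⁻¹ = u'⁻¹ + v'⁻¹) (hs : u + v ≠ 0) : u = u' ∨ u = v' := by
  have eu : u * u⁻¹ = 1 := mul_inv_cancel₀ hu
  have ev : v * v⁻¹ = 1 := mul_inv_cancel₀ hv
  have eu' : u' * u'⁻¹ = 1 := mul_inv_cancel₀ hu'
  have ev' : v' * v'⁻¹ = 1 := mul_inv_cancel₀ hv'
  have e1 : (u + v) * (u' * v') = (u' + v') * (u * v) := by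
    linear_combination (u * v * u' * v') * hc - (v * u' * v') * eu - (u * u' * v') * ev
      + (u * v * v') * eu' + (u * v * u') * ev'
  rw [← h] at e1
  have e2 : u' * v' = u * v := mul_left_cancel₀ hs e1
  have e3 : (u - u') * (u - v') = 0 := by linear_combination u * h + e2
  rcases mul_eq_zero.mp e3 with e | e
  · exact Or.inl (sub_eq_zero.mp e)
  · exact Or.inr (sub_eq_zero.mp e)

/-- **Vieta on the `p`-th roots of unity** (`p` an odd prime): `ψ a + ψ b = ψ c + ψ d` forces `{a, b} = {c, d}`. -/
theorem pair_of_sum_eq (hp : p.Prime) (hp2 : p ≠ 2) {a b c d : ZMod p}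
    (h : stdAddChar a + stdAddChar b = stdAddChar c + stdAddChar d) :
    (a = c ∧ b = d) ∨ (a = d ∧ b = c) := by
  have hconj : (stdAddChar a)⁻¹ + (stdAddChar b)⁻¹ = (stdAddChar c)⁻¹ + (stdAddChar d)⁻¹ := by
    have h' := congrArg (starRingEnd ℂ) h
    rwa [map_add, map_add, conj_stdAddChar, conj_stdAddChar, conj_stdAddChar, conj_stdAddChar] at h'
  rcases vieta_aux (stdAddChar_ne_zero a) (stdAddChar_ne_zero b) (stdAddChar_ne_zero c)
      (stdAddChar_ne_zero d) h hconj (char_add_char_ne_zero hp hp2 a b) with e | e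
  · have hbd : stdAddChar b = stdAddChar d := by linear_combination h - e
    exact Or.inl ⟨injective_stdAddChar e, injective_stdAddChar hbd⟩
  · have hbc : stdAddChar b = stdAddChar c := by linear_combination h - e
    exact Or.inr ⟨injective_stdAddChar e, injective_stdAddChar hbc⟩

end HodgeRepro.PlaneQuad
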